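import Summits.Ventures.Crystal3D.Theorems.StickyWulffConstantNoReconstructionGainCubicFrame
import Summits.Ventures.Crystal3D.Theorems.StickyWulffConstantNoReconstructionGainGrainGeom
import Summits.Ventures.Crystal3D.Theorems.StickyWulffConstantGenericWallFloorUpperNeighbourCubic
import HarnessLib

/-!
# Sealing of clamped slab samples: no foreign ball centre inside a clamp window

HONEST FRAMING. Part of the venture `Summits/Ventures/Crystal3D` (cell `crystal3d-full`), helper
`--supports` the crux `GenericWallFloor` (stmt-Ventures-19480, route
`route-Ventures-StickyWulffConstant`, line `WallLedgerG`, stub `stub_twoSlabAdhesion`).  In the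
clamped-cylinder cells of `GenericWallFloor` / `CoaxialWallLaw` / `NoReconstructionGain` a slab
sample `P = Λ ∩ ([a, b] × disc ρ)` of a MOVED fcc lattice `Λ = A·Λ₀ + t` is complete (every site of
`Λ` in the window is a ball of the packing `X`).  This file proves that the window is then SEALED:
no other ball of `X` — on or off any lattice — has its centre in `[a, b − 1] × disc(ρ − 1)` when
nothing of `X` lies below height `a` (bottom clamp), nor in `[a + 1, b] × disc(ρ − 1)` when nothing
lies above height `b` (top clamp).  So the filling of the wall cell meets the clamped samples only
through their inner faces (a skin of thickness `1`) and the lateral rim; the outer faces are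
genuinely free.

* `two_inner_eq_cubic` — polarisation of the cubic frame: `2⟪p,ν⟫ = A(p)A(ν) + B(p)B(ν) + C(p)C(ν)`;
  `dist_lt_one_of_cubic`, `inner_le_inner_of_cubic`, `mem_fcc_of_cubic_int` — transfer lemmas.
* `fcc_exists_near_ge` — **upper-neighbour lemma for `Λ₀`**: every `q ∉ Λ₀` has, for every `ν`,
  a site `v ∈ Λ₀` with `dist q v < 1` and `⟪q,ν⟫ ≤ ⟪v,ν⟫` (from `D3_exists_near_ge` of
  `…UpperNeighbourCubic` through the cubic frame of `…NoReconstructionGainCubicFrame`).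
* `movedFcc_exists_near_ge`, `movedFcc_exists_near_above`, `movedFcc_exists_near_below` — the same
  for `A·Λ₀ + t`, and with `ν = ±e₃`: a site strictly within distance `1` at height `≥` / `≤` that
  of `q`.
* `sealing_below`, `sealing_above` — **the sealing lemmas** in the vocabulary of
  `TwoSlabAdhesion`: for a unit-separated finite `X ⊇ P` with
  `p ∈ P ↔ p ∈ Λ ∧ a ≤ p₂ ≤ b ∧ p₀² + p₁² ≤ ρ²`, a ball `q ∈ X \ P` cannot have
  `a ≤ q₂ ≤ b − 1` (resp. `a + 1 ≤ q₂ ≤ b`) and `q₀² + q₁² ≤ (ρ − 1)²`.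

WHAT THIS IS NOT: no statement about the inner faces or the crux's constants; rung F-C1 not moved.
-/

noncomputable section

namespace Summit.Ventures.Crystal3D.Theorems

open Summit.Ventures.Crystal3D Finset
open Literature.MathematicalPhysics.StatisticalMechanics (barlowPos fccStacking constHagg
  barlowPos_mem)
open scoped InnerProductSpace

/-! ## The cubic frame: polarisation and the upper-neighbour lemma for `Λ₀` -/

/-- **Polarisation of the cubic frame**: `2⟪p, ν⟫ = A(p)A(ν) + B(p)B(ν) + C(p)C(ν)`. -/
theorem two_inner_eq_cubic (p ν : EuclideanSpace ℝ (Fin 3)) :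
    2 * ⟪p, ν⟫_ℝ =
      (p 0 + Real.sqrt 3 / 3 * p 1 - Real.sqrt (2 / 3) * p 2) *
          (ν 0 + Real.sqrt 3 / 3 * ν 1 - Real.sqrt (2 / 3) * ν 2) +
        (p 0 - Real.sqrt 3 / 3 * p 1 + Real.sqrt (2 / 3) * p 2) *
          (ν 0 - Real.sqrt 3 / 3 * ν 1 + Real.sqrt (2 / 3) * ν 2) +
        (2 * Real.sqrt 3 / 3 * p 1 + Real.sqrt (2 / 3) * p 2) *
          (2 * Real.sqrt 3 / 3 * ν 1 + Real.sqrt (2 / 3) * ν 2) := by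
  obtain ⟨h3, h23⟩ := sqrt_three_sq_and
  have hinner : ⟪p, ν⟫_ℝ = p 0 * ν 0 + p 1 * ν 1 + p 2 * ν 2 := by
    simp [PiLp.inner_apply, Fin.sum_univ_three, mul_comm]
  rw [hinner]
  linear_combination (-(2 : ℝ) / 3 * p 1 * ν 1) * h3 - 3 * p 2 * ν 2 * h23

/-- Strict unit distance from the cubic coordinates: if the cubic coordinate differences of
`p` and `s` have squared sum `< 2` then `dist p s < 1`. -/
theorem dist_lt_one_of_cubic (p s : EuclideanSpace ℝ (Fin 3))
    (h : (p 0 + Real.sqrt 3 / 3 * p 1 - Real.sqrt (2 / 3) * p 2 -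
            (s 0 + Real.sqrt 3 / 3 * s 1 - Real.sqrt (2 / 3) * s 2)) ^ 2 +
        (p 0 - Real.sqrt 3 / 3 * p 1 + Real.sqrt (2 / 3) * p 2 -
            (s 0 - Real.sqrt 3 / 3 * s 1 + Real.sqrt (2 / 3) * s 2)) ^ 2 +
        (2 * Real.sqrt 3 / 3 * p 1 + Real.sqrt (2 / 3) * p 2 -
            (2 * Real.sqrt 3 / 3 * s 1 + Real.sqrt (2 / 3) * s 2)) ^ 2 < 2) :
    dist p s < 1 := by
  have h2 := two_mul_norm_sq_eq_cubic (p - s)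
  simp only [PiLp.sub_apply] at h2
  have e : (p 0 + Real.sqrt 3 / 3 * p 1 - Real.sqrt (2 / 3) * p 2 -
            (s 0 + Real.sqrt 3 / 3 * s 1 - Real.sqrt (2 / 3) * s 2)) ^ 2 +
        (p 0 - Real.sqrt 3 / 3 * p 1 + Real.sqrt (2 / 3) * p 2 -
            (s 0 - Real.sqrt 3 / 3 * s 1 + Real.sqrt (2 / 3) * s 2)) ^ 2 +
        (2 * Real.sqrt 3 / 3 * p 1 + Real.sqrt (2 / 3) * p 2 -
            (2 * Real.sqrt 3 / 3 * s 1 + Real.sqrt (2 / 3) * s 2)) ^ 2 =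
      (p 0 - s 0 + Real.sqrt 3 / 3 * (p 1 - s 1) - Real.sqrt (2 / 3) * (p 2 - s 2)) ^ 2 +
        (p 0 - s 0 - Real.sqrt 3 / 3 * (p 1 - s 1) + Real.sqrt (2 / 3) * (p 2 - s 2)) ^ 2 +
        (2 * Real.sqrt 3 / 3 * (p 1 - s 1) + Real.sqrt (2 / 3) * (p 2 - s 2)) ^ 2 := by ring
  rw [e] at h
  have hn2 : ‖p - s‖ ^ 2 < 1 := by linarith
  have hn : ‖p - s‖ < 1 := by
    by_contra hc
    push Not at hc
    nlinarith [norm_nonneg (p - s)]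
  rwa [dist_eq_norm]

/-- Comparison of `⟪·, ν⟫` from the cubic coordinates (polarisation). -/
theorem inner_le_inner_of_cubic (p s ν : EuclideanSpace ℝ (Fin 3))
    (h : (ν 0 + Real.sqrt 3 / 3 * ν 1 - Real.sqrt (2 / 3) * ν 2) *
            (p 0 + Real.sqrt 3 / 3 * p 1 - Real.sqrt (2 / 3) * p 2) +
          (ν 0 - Real.sqrt 3 / 3 * ν 1 + Real.sqrt (2 / 3) * ν 2) *
            (p 0 - Real.sqrt 3 / 3 * p 1 + Real.sqrt (2 / 3) * p 2) +
          (2 * Real.sqrt 3 / 3 * ν 1 + Real.sqrt (2 / 3) * ν 2) *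
            (2 * Real.sqrt 3 / 3 * p 1 + Real.sqrt (2 / 3) * p 2) ≤
        (ν 0 + Real.sqrt 3 / 3 * ν 1 - Real.sqrt (2 / 3) * ν 2) *
            (s 0 + Real.sqrt 3 / 3 * s 1 - Real.sqrt (2 / 3) * s 2) +
          (ν 0 - Real.sqrt 3 / 3 * ν 1 + Real.sqrt (2 / 3) * ν 2) *
            (s 0 - Real.sqrt 3 / 3 * s 1 + Real.sqrt (2 / 3) * s 2) +
          (2 * Real.sqrt 3 / 3 * ν 1 + Real.sqrt (2 / 3) * ν 2) *
            (2 * Real.sqrt 3 / 3 * s 1 + Real.sqrt (2 / 3) * s 2)) :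
    ⟪p, ν⟫_ℝ ≤ ⟪s, ν⟫_ℝ := by
  have hp := two_inner_eq_cubic p ν
  have hs := two_inner_eq_cubic s ν
  nlinarith [hp, hs, h]

/-- A point whose cubic coordinates form an even-sum integer triple is a site of `Λ₀`. -/
theorem mem_fcc_of_cubic_int (q : EuclideanSpace ℝ (Fin 3)) (a b c : ℤ) (he : Even (a + b + c))
    (ha : (a : ℝ) = q 0 + Real.sqrt 3 / 3 * q 1 - Real.sqrt (2 / 3) * q 2)
    (hb : (b : ℝ) = q 0 - Real.sqrt 3 / 3 * q 1 + Real.sqrt (2 / 3) * q 2)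
    (hc : (c : ℝ) = 2 * Real.sqrt 3 / 3 * q 1 + Real.sqrt (2 / 3) * q 2) :
    q ∈ fccStacking 1 (Real.sqrt (2 / 3)) := by
  obtain ⟨k, i, j, hij, hik, hjk⟩ := barlowPos_of_cubic a b c he
  obtain ⟨hA, hB, hC⟩ := cubic_barlowPos k i j
  have ha' : (a : ℝ) = i + j := by exact_mod_cast hij.symm
  have hb' : (b : ℝ) = i + k := by exact_mod_cast hik.symm
  have hc' : (c : ℝ) = j + k := by exact_mod_cast hjk.symm
  have h2 := two_mul_norm_sq_eq_cubic (q - barlowPos 1 (Real.sqrt (2 / 3)) constHagg k i j)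
  simp only [PiLp.sub_apply] at h2
  rw [← ha', ha] at hA
  rw [← hb', hb] at hB
  rw [← hc', hc] at hC
  -- all three cubic differences vanish
  have e : 2 * ‖q - barlowPos 1 (Real.sqrt (2 / 3)) constHagg k i j‖ ^ 2 = 0 := by
    rw [h2]
    have d1 : q 0 - barlowPos 1 (Real.sqrt (2 / 3)) constHagg k i j 0 +
        Real.sqrt 3 / 3 * (q 1 - barlowPos 1 (Real.sqrt (2 / 3)) constHagg k i j 1) -
        Real.sqrt (2 / 3) * (q 2 - barlowPos 1 (Real.sqrt (2 / 3)) constHagg k i j 2) = 0 := by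
      linarith
    have d2 : q 0 - barlowPos 1 (Real.sqrt (2 / 3)) constHagg k i j 0 -
        Real.sqrt 3 / 3 * (q 1 - barlowPos 1 (Real.sqrt (2 / 3)) constHagg k i j 1) +
        Real.sqrt (2 / 3) * (q 2 - barlowPos 1 (Real.sqrt (2 / 3)) constHagg k i j 2) = 0 := by
      linarith
    have d3 : 2 * Real.sqrt 3 / 3 * (q 1 - barlowPos 1 (Real.sqrt (2 / 3)) constHagg k i j 1) +
        Real.sqrt (2 / 3) * (q 2 - barlowPos 1 (Real.sqrt (2 / 3)) constHagg k i j 2) = 0 := by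
      linarith
    rw [d1, d2, d3]; norm_num
  have hn : ‖q - barlowPos 1 (Real.sqrt (2 / 3)) constHagg k i j‖ = 0 := by
    nlinarith [norm_nonneg (q - barlowPos 1 (Real.sqrt (2 / 3)) constHagg k i j)]
  have : q = barlowPos 1 (Real.sqrt (2 / 3)) constHagg k i j := by
    rwa [norm_eq_zero, sub_eq_zero] at hn
  rw [this]; exact barlowPos_mem _ _ _

/-- **Upper-neighbour lemma for `Λ₀ = fccStacking 1 √(2/3)`.**  Every point `q ∉ Λ₀` has, for
every vector `ν`, a site `v ∈ Λ₀` with `dist q v < 1` and `⟪q, ν⟫ ≤ ⟪v, ν⟫` (the non-site `q`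
lies in the convex hull of the sites at distance `< 1`: Delaunay tetrahedra and octahedra). -/
theorem fcc_exists_near_ge (q ν : EuclideanSpace ℝ (Fin 3))
    (hq : q ∉ fccStacking 1 (Real.sqrt (2 / 3))) :
    ∃ v ∈ fccStacking 1 (Real.sqrt (2 / 3)), dist q v < 1 ∧ ⟪q, ν⟫_ℝ ≤ ⟪v, ν⟫_ℝ := by
  have hD : ∀ a b c : ℤ, Even (a + b + c) →
      ¬((a : ℝ) = q 0 + Real.sqrt 3 / 3 * q 1 - Real.sqrt (2 / 3) * q 2 ∧
        (b : ℝ) = q 0 - Real.sqrt 3 / 3 * q 1 + Real.sqrt (2 / 3) * q 2 ∧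
        (c : ℝ) = 2 * Real.sqrt 3 / 3 * q 1 + Real.sqrt (2 / 3) * q 2) :=
    fun a b c he h => hq (mem_fcc_of_cubic_int q a b c he h.1 h.2.1 h.2.2)
  obtain ⟨a, b, c, he, hd, hl⟩ := D3_exists_near_ge
    (q 0 + Real.sqrt 3 / 3 * q 1 - Real.sqrt (2 / 3) * q 2)
    (q 0 - Real.sqrt 3 / 3 * q 1 + Real.sqrt (2 / 3) * q 2)
    (2 * Real.sqrt 3 / 3 * q 1 + Real.sqrt (2 / 3) * q 2)
    (ν 0 + Real.sqrt 3 / 3 * ν 1 - Real.sqrt (2 / 3) * ν 2)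
    (ν 0 - Real.sqrt 3 / 3 * ν 1 + Real.sqrt (2 / 3) * ν 2)
    (2 * Real.sqrt 3 / 3 * ν 1 + Real.sqrt (2 / 3) * ν 2) hD
  obtain ⟨k, i, j, hij, hik, hjk⟩ := barlowPos_of_cubic a b c he
  obtain ⟨hA, hB, hC⟩ := cubic_barlowPos k i j
  have ha : (a : ℝ) = i + j := by exact_mod_cast hij.symm
  have hb : (b : ℝ) = i + k := by exact_mod_cast hik.symm
  have hc : (c : ℝ) = j + k := by exact_mod_cast hjk.symm
  rw [ha, ← hA, hb, ← hB, hc, ← hC] at hd hl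
  exact ⟨_, barlowPos_mem _ _ _, dist_lt_one_of_cubic _ _ hd, inner_le_inner_of_cubic _ _ _ hl⟩

/-! ## Moved lattices `A·Λ₀ + t` -/

/-- **Upper-neighbour lemma for a moved fcc lattice** `Λ = A·Λ₀ + t` (`A` a linear isometry):
every `q ∉ Λ` has, for every `ν`, a point `v ∈ Λ` with `dist q v < 1` and `⟪q,ν⟫ ≤ ⟪v,ν⟫`. -/
theorem movedFcc_exists_near_ge
    (A : EuclideanSpace ℝ (Fin 3) ≃ₗᵢ[ℝ] EuclideanSpace ℝ (Fin 3))
    (t q ν : EuclideanSpace ℝ (Fin 3))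
    (hq : q ∉ (fun p => A p + t) '' fccStacking 1 (Real.sqrt (2 / 3))) :
    ∃ v ∈ (fun p => A p + t) '' fccStacking 1 (Real.sqrt (2 / 3)),
      dist q v < 1 ∧ ⟪q, ν⟫_ℝ ≤ ⟪v, ν⟫_ℝ := by
  set q' := A.symm (q - t) with hq'
  have hqq : A q' + t = q := by rw [hq', LinearIsometryEquiv.apply_symm_apply, sub_add_cancel]
  have hq'Λ : q' ∉ fccStacking 1 (Real.sqrt (2 / 3)) := fun h => hq ⟨q', h, hqq⟩
  obtain ⟨v', hv'Λ, hd, hl⟩ := fcc_exists_near_ge q' (A.symm ν) hq'Λ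
  refine ⟨A v' + t, ⟨v', hv'Λ, rfl⟩, ?_, ?_⟩
  · rw [← hqq, dist_add_right, LinearIsometryEquiv.dist_map]; exact hd
  · have hν : A (A.symm ν) = ν := LinearIsometryEquiv.apply_symm_apply _ _
    have h1 : ⟪q', A.symm ν⟫_ℝ = ⟪A q', ν⟫_ℝ := by
      rw [← LinearIsometryEquiv.inner_map_map A q' (A.symm ν), hν]
    have h2 : ⟪v', A.symm ν⟫_ℝ = ⟪A v', ν⟫_ℝ := by
      rw [← LinearIsometryEquiv.inner_map_map A v' (A.symm ν), hν]
    rw [← hqq, inner_add_left, inner_add_left, ← h1, ← h2]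
    linarith

/-- `⟪p, e₃⟫ = p₂`. -/
theorem inner_single_two_one (p : EuclideanSpace ℝ (Fin 3)) :
    ⟪p, EuclideanSpace.single (2 : Fin 3) (1 : ℝ)⟫_ℝ = p 2 := by
  rw [EuclideanSpace.inner_single_right]; simp

/-- **A near lattice point at least as high**: every `q ∉ Λ = A·Λ₀ + t` has `v ∈ Λ` with
`dist q v < 1` and `q₂ ≤ v₂`. -/
theorem movedFcc_exists_near_above
    (A : EuclideanSpace ℝ (Fin 3) ≃ₗᵢ[ℝ] EuclideanSpace ℝ (Fin 3)) (t q : EuclideanSpace ℝ (Fin 3))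
    (hq : q ∉ (fun p => A p + t) '' fccStacking 1 (Real.sqrt (2 / 3))) :
    ∃ v ∈ (fun p => A p + t) '' fccStacking 1 (Real.sqrt (2 / 3)), dist q v < 1 ∧ q 2 ≤ v 2 := by
  obtain ⟨v, hv, hd, hl⟩ :=
    movedFcc_exists_near_ge A t q (EuclideanSpace.single (2 : Fin 3) (1 : ℝ)) hq
  rw [inner_single_two_one, inner_single_two_one] at hl
  exact ⟨v, hv, hd, hl⟩

/-- **A near lattice point at most as high**: every `q ∉ Λ = A·Λ₀ + t` has `v ∈ Λ` with
`dist q v < 1` and `v₂ ≤ q₂`. -/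
theorem movedFcc_exists_near_below
    (A : EuclideanSpace ℝ (Fin 3) ≃ₗᵢ[ℝ] EuclideanSpace ℝ (Fin 3)) (t q : EuclideanSpace ℝ (Fin 3))
    (hq : q ∉ (fun p => A p + t) '' fccStacking 1 (Real.sqrt (2 / 3))) :
    ∃ v ∈ (fun p => A p + t) '' fccStacking 1 (Real.sqrt (2 / 3)), dist q v < 1 ∧ v 2 ≤ q 2 := by
  obtain ⟨v, hv, hd, hl⟩ :=
    movedFcc_exists_near_ge A t q (-EuclideanSpace.single (2 : Fin 3) (1 : ℝ)) hq
  rw [inner_neg_right, inner_neg_right, inner_single_two_one, inner_single_two_one] at hl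
  exact ⟨v, hv, hd, by linarith⟩

/-! ## The sealing lemmas -/

/-- **Sealing below.**  Let `Λ = A·Λ₀ + t`, let `X` be a finite unit-separated set and
`P ⊆ X` the complete slab sample `P = {p : p ∈ Λ, a ≤ p₂ ≤ b, p₀² + p₁² ≤ ρ²}` (`ρ ≥ 1`).
Then NO point `q ∈ X \ P` has `a ≤ q₂ ≤ b − 1` and `q₀² + q₁² ≤ (ρ − 1)²`: either `q ∈ Λ`, and
then `q ∈ P`; or the upper neighbour `v ∈ Λ` of `q` (`dist q v < 1`, `q₂ ≤ v₂ < q₂ + 1 ≤ b`,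
laterally within `ρ`) lies in `P ⊆ X` at distance `< 1` from `q`.  (Bottom clamp: `a` = the
container floor, so `a ≤ q₂` is automatic for every ball.) -/
theorem sealing_below
    (A : EuclideanSpace ℝ (Fin 3) ≃ₗᵢ[ℝ] EuclideanSpace ℝ (Fin 3)) (t : EuclideanSpace ℝ (Fin 3))
    (a b ρ : ℝ) (hρ : 1 ≤ ρ) (X P : Finset (EuclideanSpace ℝ (Fin 3)))
    (hX : ∀ p ∈ X, ∀ q ∈ X, p ≠ q → 1 ≤ dist p q) (hPX : P ⊆ X)
    (hP : ∀ p, p ∈ P ↔ (p ∈ (fun s => A s + t) '' fccStacking 1 (Real.sqrt (2 / 3)) ∧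
      a ≤ p 2 ∧ p 2 ≤ b ∧ p 0 ^ 2 + p 1 ^ 2 ≤ ρ ^ 2))
    (q : EuclideanSpace ℝ (Fin 3)) (hqX : q ∈ X) (hqP : q ∉ P)
    (ha : a ≤ q 2) (hb : q 2 ≤ b - 1) (hr : q 0 ^ 2 + q 1 ^ 2 ≤ (ρ - 1) ^ 2) : False := by
  have hρ' : (ρ - 1) ^ 2 ≤ ρ ^ 2 := by nlinarith
  by_cases hqΛ : q ∈ (fun s => A s + t) '' fccStacking 1 (Real.sqrt (2 / 3))
  · exact hqP ((hP q).2 ⟨hqΛ, ha, by linarith, hr.trans hρ'⟩)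
  obtain ⟨v, hvΛ, hd, hz⟩ := movedFcc_exists_near_above A t q hqΛ
  rw [dist_comm] at hd
  have hd2 : dist v q ^ 2 < 1 := by
    have := pow_lt_pow_left₀ hd dist_nonneg (two_ne_zero)
    simpa using this
  have hsq := dist_sq_eq_three v q
  have hz' : v 2 < q 2 + 1 := by nlinarith [sq_nonneg (v 0 - q 0), sq_nonneg (v 1 - q 1)]
  have hlat : v 0 ^ 2 + v 1 ^ 2 ≤ ρ ^ 2 := by
    have := lateral_sq_le_of_dist_le_one (y := v) (q := q) (r := ρ - 1) (by linarith) hr hd.le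
    simpa using this
  have hvP : v ∈ P := (hP v).2 ⟨hvΛ, by linarith, by linarith, hlat⟩
  have hne : v ≠ q := fun h => hqΛ (h ▸ hvΛ)
  have := hX v (hPX hvP) q hqX hne
  linarith

/-- **Sealing above.**  Same setting; NO point `q ∈ X \ P` has `a + 1 ≤ q₂ ≤ b` and
`q₀² + q₁² ≤ (ρ − 1)²` (use the lower neighbour).  (Top clamp: `b` = the container ceiling, so
`q₂ ≤ b` is automatic for every ball.) -/
theorem sealing_above
    (A : EuclideanSpace ℝ (Fin 3) ≃ₗᵢ[ℝ] EuclideanSpace ℝ (Fin 3)) (t : EuclideanSpace ℝ (Fin 3))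
    (a b ρ : ℝ) (hρ : 1 ≤ ρ) (X P : Finset (EuclideanSpace ℝ (Fin 3)))
    (hX : ∀ p ∈ X, ∀ q ∈ X, p ≠ q → 1 ≤ dist p q) (hPX : P ⊆ X)
    (hP : ∀ p, p ∈ P ↔ (p ∈ (fun s => A s + t) '' fccStacking 1 (Real.sqrt (2 / 3)) ∧
      a ≤ p 2 ∧ p 2 ≤ b ∧ p 0 ^ 2 + p 1 ^ 2 ≤ ρ ^ 2))
    (q : EuclideanSpace ℝ (Fin 3)) (hqX : q ∈ X) (hqP : q ∉ P)
    (ha : a + 1 ≤ q 2) (hb : q 2 ≤ b) (hr : q 0 ^ 2 + q 1 ^ 2 ≤ (ρ - 1) ^ 2) : False := by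
  have hρ' : (ρ - 1) ^ 2 ≤ ρ ^ 2 := by nlinarith
  by_cases hqΛ : q ∈ (fun s => A s + t) '' fccStacking 1 (Real.sqrt (2 / 3))
  · exact hqP ((hP q).2 ⟨hqΛ, by linarith, hb, hr.trans hρ'⟩)
  obtain ⟨v, hvΛ, hd, hz⟩ := movedFcc_exists_near_below A t q hqΛ
  rw [dist_comm] at hd
  have hd2 : dist v q ^ 2 < 1 := by
    have := pow_lt_pow_left₀ hd dist_nonneg (two_ne_zero)
    simpa using this
  have hsq := dist_sq_eq_three v q
  have hz' : q 2 - 1 < v 2 := by nlinarith [sq_nonneg (v 0 - q 0), sq_nonneg (v 1 - q 1)]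
  have hlat : v 0 ^ 2 + v 1 ^ 2 ≤ ρ ^ 2 := by
    have := lateral_sq_le_of_dist_le_one (y := v) (q := q) (r := ρ - 1) (by linarith) hr hd.le
    simpa using this
  have hvP : v ∈ P := (hP v).2 ⟨hvΛ, by linarith, by linarith, hlat⟩
  have hne : v ≠ q := fun h => hqΛ (h ▸ hvΛ)
  have := hX v (hPX hvP) q hqX hne
  linarith

end Summit.Ventures.Crystal3D.Theorems

end
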